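import Summits.BirchSwinnertonDyer.Rank1Residual.X2.NonsplitMainConjectureConverse
import Summits.BirchSwinnertonDyer.Rank1Residual.X2.RankZero
import Literature.NumberTheory.EllipticCurves.Wuthrich2014.ShaBoundProofs
import Literature.NumberTheory.EllipticCurves.Rank1Residual.X1MainConjecture
import HarnessLib

/-!
# Class X2, NON-SPLIT multiplicative Eisenstein prime: Mazur's main conjecture at the pair ⟺ the
# rank-`0` `p`-part of BSD — and the `Ш`-UNIT road with NO relative
# (cell `bsd-eis`, seat `bsd-eis-k5-c3` gen 6; rung K5 crux 3 `MazurMCOnCellB` = stmt-BirchSwinnertonDyer-19033;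
# row A10 non-split; THEOREMS ONLY; file 2 of 3 — core converse in `X2/NonsplitMainConjectureConverse.lean`)

HONEST FRAMING (FULL-BSD rank-≤1 programme D-0033, cell `bsd-eis`, home `run/shared/lean/pub/bsd-eis/`;
row A10 = corner X2b: `(E₀, 3)`, `r = 0`, multiplicative Eisenstein `3`, `¬GVPar`; 44 non-split cells).
Nothing booked, no label moves; the class-wide crux `MazurMCOnCellB` is NOT claimed. Theorems only (no
definition, no named fact, nothing asserted): every published theorem enters as one of the tree's
existing NAMED FACTS, taken as a hypothesis.

Contents (all at a NON-SPLIT multiplicative `p ≠ 2` with `E[p]` reducible, `r_an = 0`):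
* §2 `mazurMainConjectureAt_of_missingLowerBoundAt_of_nonsplit` (`hWu h41 + hGZK`),
  `…_of_bsdp_of_nonsplit`, and **the `Ш`-unit road with no relative**
  `mazurMainConjectureAt_of_shaAn_unit_of_nonsplit` (`+ hW21`): `r_an = 0 ∧ p ∤ #Ш(E)_an ⟹` Mazur's MC
  at `(E,p)` — NO congruent relative, NO `(μ_an, λ_an)` reading, NO anomaly/`GVPar` hypothesis (the
  X2-non-split twin of `X2.mazurMainConjecture_of_shaAn_unit_of_goodOrdinary`); `…_of_analyticRank_eq_zero`
  (`+ hpar`); `mazurMainConjectureAt_and_bsdp_of_shaAn_unit_of_nonsplit`.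
* §3 `bsdp_of_mazurMainConjectureAt_of_nonsplit_of_analyticRank_eq_zero` — the non-split branch of the
  tree's forward glue with exactly the facts it uses (`hJn hHn hGZK hmod hpar`; no `hJs hHs hGS`) — and
  `mazurMainConjectureAt_iff_bsdp_of_nonsplit`: **at a rank-`0` non-split X2 pair, Mazur's main
  conjecture ⟺ Miller's `BSD(E,p)`** on the published record.
* §4 cell forms: `missingInputB_of_cellB_of_not_split_of_shaAn_unit`,
  `mazurMainConjectureAt_iff_bsdp_of_cellB_of_not_split`,
  `forall_cellB_nonsplit_mazurMainConjectureAt_iff_bsdp` — the NON-SPLIT half of crux 3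
  (`MazurMCOnCellB`) and the non-split half of the cell target `X2.TargetB` are ONE statement: what is
  missing at each of the 44 non-split A10 cells is the LOWER bound `ord_p #Ш_an ≤ ord_p #Ш(E/ℚ)(p)` at
  the target (the upper bound being Wuthrich Prop. 21), a statement about `Ш`, nothing
  Iwasawa-theoretic.

Binder sets. Relative-free road (§2): class level {hW21 hWu h41 hGZK hpar} (all PUBLISHED; `h41` =
GreenbergLNM1716 §4 pp. 112–113, b2b registry A103), per pair `hmult hns hred` (kernel), `hr0 hunit`
(instrument: Cremona / two implementations of `#Ш_an`).

References: [Wuthrich2014] Thm. 16 (p. 397), Prop. 21 (p. 400); [GreenbergLNM1716] §4 pp. 112–113, §5;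
[SteinWuthrich2013] Thm. 6.1 (p. 20), §4.2; [Miller2011LMS] Def. 1.1; [BCDTJAMS2001] Thm. A.
-/

set_option autoImplicit false

noncomputable section

open scoped Classical MatrixGroups ModularForm NumberField

open PowerSeries CongruenceSubgroup WeierstrassCurve NumberField IsDedekindDomain Rat.HeightOneSpectrum
  Literature.NumberTheory.EllipticCurves
  Literature.NumberTheory.EllipticCurves.ModularForms
  Literature.NumberTheory.EllipticCurves.Rank1Residual
  Literature.NumberTheory.EllipticCurves.Rank1Residual.Typed
  Literature.NumberTheory.EllipticCurves.Wuthrich2014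
  Literature.NumberTheory.EllipticCurves.SteinWuthrich2013
  Literature.NumberTheory.EllipticCurves.Greenberg1999

namespace Summit.BirchSwinnertonDyer.Rank1Residual.X2

section Converse

variable (W : WeierstrassCurve ℚ) [W.IsElliptic] [W.IsGloballyMinimal] (p : ℕ) [Fact p.Prime]

/-! ## §2. Consequences: from the typed lower bound, from `BSD(E,p)`, from `p ∤ #Ш_an` -/

/-- **`ord_p #Ш(E/ℚ)_an ≤ ord_p #Ш(E/ℚ)` ⟹ Mazur's main conjecture at a NON-SPLIT X2 pair** (rank
`0`): same setting as `mazurMainConjectureAt_of_padicValRat_le_of_nonsplit`, with Gross–Zagier–Kolyvagin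
(`hGZK`) for `rank E(ℚ) = 0` and the finiteness of `Ш`; the hypothesis is the cell's typed lower bound
`Typed.MissingLowerBoundAt W p` (`#Ш_an = (L(E,1)/Ω_E)·#E(ℚ)²/∏ c_ℓ`, `shaAn_eq_of_L_one_div_eq`).
[cite: GreenbergLNM1716, §4 pp. 112–113 and §5 (closing examples)] [cite: Wuthrich2014, Thm. 16 (p. 397)]
[cite: Miller2011LMS, Def. 1.1 (arXiv:1010.2431 p. 3)] -/
theorem mazurMainConjectureAt_of_missingLowerBoundAt_of_nonsplit
    (hWu : thm16_charIdeal_dvd_multiplicative_of_reducible)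
    (h41 : thm41Analogue_charValue_rankZero_numberField)
    (hGZK : rank_eq_analyticRank_of_analyticRank_le_one) (hp2 : p ≠ 2)
    (hmult : W.HasMultiplicativeReductionAtPrime p) (hns : ¬ W.HasSplitMultiplicativeReductionAtPrime p)
    (hred : ¬ W.HasIrreducibleModPGaloisRep p) (hL : W.entireLFunction 1 ≠ 0)
    (hlow : Typed.MissingLowerBoundAt W p) : X2.MazurMainConjectureAt W p := by
  have hr0 : W.analyticRank = 0 := analyticRank_eq_zero_of_entireLFunction_one_ne_zero W hL
  obtain ⟨-, hfin⟩ := hGZK W (by rw [hr0]; exact zero_le_one)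
  refine mazurMainConjectureAt_of_padicValRat_le_of_nonsplit W p hWu h41 hp2 hmult hns hred hL hfin ?_
  intro q hq
  obtain ⟨-, hE, -, hshaAn⟩ := shaAn_eq_of_L_one_div_eq hGZK W hL hq
  haveI := hE
  obtain ⟨q', hq', hle'⟩ := hlow
  have hqq : q' = q * (Nat.card W.toAffine.Point : ℚ) ^ 2 / (W.tamagawaProduct : ℚ) := by
    exact_mod_cast hq'.symm.trans hshaAn
  have hΩ : (W.realPeriodRat : ℂ) ≠ 0 := by exact_mod_cast W.realPeriodRat_pos_holds.ne'
  have hq0 : q ≠ 0 := by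
    rintro rfl
    apply hL
    rw [Rat.cast_zero, div_eq_zero_iff] at hq
    exact hq.resolve_right hΩ
  have hcard : (Nat.card W.toAffine.Point : ℚ) ≠ 0 := by
    exact_mod_cast (Nat.card_pos (α := W.toAffine.Point)).ne'
  have htam : (W.tamagawaProduct : ℚ) ≠ 0 := by
    exact_mod_cast (W.tamagawaProduct_pos_holds : 0 < W.tamagawaProduct).ne'
  have hcardT : (Nat.card W.toAffine.Point : ℚ) = (W.torsionOrder : ℚ) := by
    exact_mod_cast (W.torsionOrder_eq_natCard_of_finite).symm
  rw [hqq, padicValRat.div (mul_ne_zero hq0 (pow_ne_zero 2 hcard)) htam,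
    padicValRat.mul hq0 (pow_ne_zero 2 hcard), padicValRat.pow, hcardT] at hle'
  simp only [padicValRat.of_nat, Nat.cast_ofNat] at hle'
  linarith

/-- **`BSD(E, p)` ⟹ Mazur's main conjecture at a NON-SPLIT X2 pair** (rank `0`, `E[p]` reducible,
`p ≠ 2`): Miller's `BSDp W p` contains `ord_p #Ш_an = ord_p #Ш(p)`, whose lower half feeds
`mazurMainConjectureAt_of_missingLowerBoundAt_of_nonsplit`.
[cite: GreenbergLNM1716, §4 pp. 112–113 and §5 (closing examples)] [cite: Wuthrich2014, Thm. 16 (p. 397)]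
[cite: Miller2011LMS, Def. 1.1 (arXiv:1010.2431 p. 3)] -/
theorem mazurMainConjectureAt_of_bsdp_of_nonsplit
    (hWu : thm16_charIdeal_dvd_multiplicative_of_reducible)
    (h41 : thm41Analogue_charValue_rankZero_numberField)
    (hGZK : rank_eq_analyticRank_of_analyticRank_le_one) (hp2 : p ≠ 2)
    (hmult : W.HasMultiplicativeReductionAtPrime p) (hns : ¬ W.HasSplitMultiplicativeReductionAtPrime p)
    (hred : ¬ W.HasIrreducibleModPGaloisRep p) (hL : W.entireLFunction 1 ≠ 0) (hbsd : BSDp W p) :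
    X2.MazurMainConjectureAt W p := by
  have hr0 : W.analyticRank = 0 := analyticRank_eq_zero_of_entireLFunction_one_ne_zero W hL
  obtain ⟨-, hfin⟩ := hGZK W (by rw [hr0]; exact zero_le_one)
  haveI : Finite W.sha := hfin
  exact mazurMainConjectureAt_of_missingLowerBoundAt_of_nonsplit W p hWu h41 hGZK hp2 hmult hns hred hL
    (Typed.lower_and_upper_of_missingPPartAt W p (Typed.missingPPartAt_of_bsdp W p hbsd)).1

/-- **THE `Ш`-UNIT ROAD WITH NO RELATIVE: `p ∤ #Ш(E/ℚ)_an` ⟹ Mazur's main conjecture at a NON-SPLIT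
X2 pair.** For `W/ℚ` globally minimal, `p ≠ 2` a prime of NON-SPLIT multiplicative reduction with
`E[p]` REDUCIBLE and `L(E,1) ≠ 0`: if `#Ш(E/ℚ)_an` is a rational number of `p`-adic valuation `0`
(instrument certificate `hunit`), then `X2.MazurMainConjectureAt W p`. Chain: Wuthrich 2014 Prop. 21
(`hW21`, + GZK) gives Miller's `BSD(E,p)` (`bsdp_of_L_one_ne_zero_of_padicValRat_shaAn_eq_zero`;
multiplicative ⇒ not additive), then `mazurMainConjectureAt_of_bsdp_of_nonsplit` (`hWu h41`). NO
congruent relative, NO `(μ_an, λ_an)` reading, NO anomaly/`GVPar` hypothesis — the X2-non-split twin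
of `X2.mazurMainConjecture_of_shaAn_unit_of_goodOrdinary` / `Rank1ResidualX1Converse.mazurMainConjecture_of_shaAn_unit`.
[cite: Wuthrich2014, Thm. 16 (p. 397) and Prop. 21 (p. 400)] [cite: GreenbergLNM1716, §4 pp. 112–113 ("the analogue of theorem 4.1")]
[cite: Miller2011LMS, Def. 1.1 (arXiv:1010.2431 p. 3)] -/
theorem mazurMainConjectureAt_of_shaAn_unit_of_nonsplit (hW21 : sha_dvd_analyticSha)
    (hWu : thm16_charIdeal_dvd_multiplicative_of_reducible)
    (h41 : thm41Analogue_charValue_rankZero_numberField)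
    (hGZK : rank_eq_analyticRank_of_analyticRank_le_one) (hp2 : p ≠ 2)
    (hmult : W.HasMultiplicativeReductionAtPrime p) (hns : ¬ W.HasSplitMultiplicativeReductionAtPrime p)
    (hred : ¬ W.HasIrreducibleModPGaloisRep p) (hL : W.entireLFunction 1 ≠ 0)
    (hunit : ∃ q : ℚ, shaAn W = (q : ℂ) ∧ padicValRat p q = 0) : X2.MazurMainConjectureAt W p :=
  mazurMainConjectureAt_of_bsdp_of_nonsplit W p hWu h41 hGZK hp2 hmult hns hred hL
    (bsdp_of_L_one_ne_zero_of_padicValRat_shaAn_eq_zero hW21 hGZK W p hp2 hL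
      (WeierstrassCurve.HasMultiplicativeReduction.not_hasAdditiveReduction (R := ℤ_[p]) hmult)
      (Or.inl hred) hunit)

/-- **Census shape (`r_an = 0` instead of `L(E,1) ≠ 0`)**: modularity with an integral Manin constant
(`hpar`) converts `ord_{s=1} L(E,s) = 0` into `L(E,1) ≠ 0`
(`entireLFunction_one_ne_zero_of_analyticRank_eq_zero`); the rest as above. Binder set of the
relative-free display: class level `hW21 hWu h41 hGZK hpar` (all PUBLISHED), per pair `hmult hns hred`
(kernel) and `hr0`, `hunit` (instrument). [cite: Wuthrich2014, Thm. 16 (p. 397) and Prop. 21 (p. 400)]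
[cite: GreenbergLNM1716, §4 pp. 112–113] [cite: BCDTJAMS2001, Theorem A] -/
theorem mazurMainConjectureAt_of_shaAn_unit_of_nonsplit_of_analyticRank_eq_zero
    (hW21 : sha_dvd_analyticSha) (hWu : thm16_charIdeal_dvd_multiplicative_of_reducible)
    (h41 : thm41Analogue_charValue_rankZero_numberField)
    (hGZK : rank_eq_analyticRank_of_analyticRank_le_one) (hpar : nonempty_modularParametrizationData)
    (hp2 : p ≠ 2) (hmult : W.HasMultiplicativeReductionAtPrime p)
    (hns : ¬ W.HasSplitMultiplicativeReductionAtPrime p) (hred : ¬ W.HasIrreducibleModPGaloisRep p)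
    (hr0 : W.analyticRank = 0) (hunit : ∃ q : ℚ, shaAn W = (q : ℂ) ∧ padicValRat p q = 0) :
    X2.MazurMainConjectureAt W p :=
  mazurMainConjectureAt_of_shaAn_unit_of_nonsplit W p hW21 hWu h41 hGZK hp2 hmult hns hred
    (entireLFunction_one_ne_zero_of_analyticRank_eq_zero hpar W hr0) hunit

/-- **Both outputs at once** (the shape a per-pair display books): at a NON-SPLIT X2b pair with
`p ∤ #Ш(E/ℚ)_an`, Mazur's main conjecture AND Miller's `BSD(E,p)`.
[cite: Wuthrich2014, Thm. 16 (p. 397) and Prop. 21 (p. 400)] [cite: GreenbergLNM1716, §4 pp. 112–113]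
[cite: Miller2011LMS, Def. 1.1 (arXiv:1010.2431 p. 3)] -/
theorem mazurMainConjectureAt_and_bsdp_of_shaAn_unit_of_nonsplit
    (hW21 : sha_dvd_analyticSha) (hWu : thm16_charIdeal_dvd_multiplicative_of_reducible)
    (h41 : thm41Analogue_charValue_rankZero_numberField)
    (hGZK : rank_eq_analyticRank_of_analyticRank_le_one) (hpar : nonempty_modularParametrizationData)
    (hp2 : p ≠ 2) (hmult : W.HasMultiplicativeReductionAtPrime p)
    (hns : ¬ W.HasSplitMultiplicativeReductionAtPrime p) (hred : ¬ W.HasIrreducibleModPGaloisRep p)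
    (hr0 : W.analyticRank = 0) (hunit : ∃ q : ℚ, shaAn W = (q : ℂ) ∧ padicValRat p q = 0) :
    X2.MazurMainConjectureAt W p ∧ BSDp W p :=
  have hL : W.entireLFunction 1 ≠ 0 := entireLFunction_one_ne_zero_of_analyticRank_eq_zero hpar W hr0
  ⟨mazurMainConjectureAt_of_shaAn_unit_of_nonsplit W p hW21 hWu h41 hGZK hp2 hmult hns hred hL hunit,
    bsdp_of_L_one_ne_zero_of_padicValRat_shaAn_eq_zero hW21 hGZK W p hp2 hL
      (WeierstrassCurve.HasMultiplicativeReduction.not_hasAdditiveReduction (R := ℤ_[p]) hmult)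
      (Or.inl hred) hunit⟩


/-! ## §3. At a rank-`0` NON-SPLIT X2 pair, Mazur's main conjecture ⟺ `BSD(E, p)` -/

/-- **The forward glue at a NON-SPLIT prime, with exactly the facts it uses**: Mazur's main conjecture at
`(E, p)` (`X2.MazurMainConjectureAt W p`), `p ≠ 2` non-split multiplicative, `r_an = 0` ⟹ Miller's
`BSD(E, p)` — the non-split branch of the tree's `bsdp_of_mazurMainConjectureAt_of_analyticRank_eq_zero`
(Stein–Wuthrich 2013 Thm. 6.1 non-split `hJn`, existence of THE non-split height `hHn`, GZK, modularity),
without the split-only facts `hJs hHs hGS`. [cite: SteinWuthrich2013, Thm. 6.1 (p. 20) and §4.2]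
[cite: Miller2011LMS, Def. 1.1] -/
theorem bsdp_of_mazurMainConjectureAt_of_nonsplit_of_analyticRank_eq_zero
    (hJn : thm61_nonsplitMultiplicative) (hHn : exists_isMultCanonical)
    (hGZK : rank_eq_analyticRank_of_analyticRank_le_one) (hmod : hasEntireLFunction_rat)
    (hpar : nonempty_modularParametrizationData) (hp2 : p ≠ 2)
    (hmult : W.HasMultiplicativeReductionAtPrime p) (hns : ¬ W.HasSplitMultiplicativeReductionAtPrime p)
    (hr0 : W.analyticRank = 0) (hMC : X2.MazurMainConjectureAt W p) : BSDp W p := by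
  obtain ⟨κ, hκ, γ, hγ, hγ'⟩ := exists_isCyclotomic_isTopGenerator_isCyclotomicVariable_holds p
  obtain ⟨D⟩ := W.nonempty_selmerDualData_holds κ γ hγ
  haveI : NeZero (W.conductorNorm ℤ) := ⟨(W.conductorNorm_pos_holds).ne'⟩
  obtain ⟨Dm⟩ := hpar W
  obtain ⟨ϖ, hϖpos, hϖ, -⟩ := Dm.exists_rat_mul_realPeriodRat_eq_plusPeriod
  obtain ⟨hX, g, hchar, -, hnsp⟩ := hMC κ γ hκ hγ hγ' Dm.f Dm.isNewformOf D ϖ hϖ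
  obtain ⟨L, hL⟩ := exists_isMultPAdicLFunctionOf_neg_one_of_nonsplit Dm.isNewformOf hmult hns
  obtain ⟨q, ⟨hq0, hq1, hqj⟩, -⟩ := existsUnique_tateJ_eq_of_one_lt_norm
    (one_lt_norm_j_of_hasMultiplicativeReductionAtPrime (W := W) (p := p) hmult)
  obtain ⟨w, hw⟩ := hnsp hns L hL
  exact bsdp_of_multCharIdeal_nonsplit_rankZero hJn hHn hGZK hmod W p hp2 hr0 hmult hns hq0 hq1
    hqj hκ hγ hγ' Dm.isNewformOf D ϖ hϖpos.ne' hϖ L hL ⟨hX, g, w, hchar, hw⟩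

/-- **At a rank-`0` NON-SPLIT X2 pair, Mazur's main conjecture ⟺ Miller's `BSD(E, p)`** on the
published record: `W/ℚ` globally minimal, `p ≠ 2` non-split multiplicative with `E[p]` reducible,
`ord_{s=1} L(E,s) = 0`; facts Wuthrich 2014 Thm. 16 mult (`hWu`), Greenberg §4 pp. 112–113 (`h41`),
Stein–Wuthrich 2013 Thm. 6.1 non-split (`hJn`), THE non-split height (`hHn`), GZK (`hGZK`), modularity
(`hmod hpar`). (⇐ is §2; ⇒ is the glue above.) The X2-non-split twin of
`Rank1Residual.X1.mainConjecture_iff_bsdp`. [cite: GreenbergLNM1716, §4 pp. 112–113 and §5]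
[cite: Wuthrich2014, Thm. 16 (p. 397)] [cite: SteinWuthrich2013, Thm. 6.1 (p. 20)] -/
theorem mazurMainConjectureAt_iff_bsdp_of_nonsplit
    (hWu : thm16_charIdeal_dvd_multiplicative_of_reducible)
    (h41 : thm41Analogue_charValue_rankZero_numberField)
    (hJn : thm61_nonsplitMultiplicative) (hHn : exists_isMultCanonical)
    (hGZK : rank_eq_analyticRank_of_analyticRank_le_one) (hmod : hasEntireLFunction_rat)
    (hpar : nonempty_modularParametrizationData) (hp2 : p ≠ 2)
    (hmult : W.HasMultiplicativeReductionAtPrime p) (hns : ¬ W.HasSplitMultiplicativeReductionAtPrime p)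
    (hred : ¬ W.HasIrreducibleModPGaloisRep p) (hr0 : W.analyticRank = 0) :
    X2.MazurMainConjectureAt W p ↔ BSDp W p :=
  ⟨bsdp_of_mazurMainConjectureAt_of_nonsplit_of_analyticRank_eq_zero W p hJn hHn hGZK hmod hpar hp2 hmult
      hns hr0,
    fun hbsd ↦ mazurMainConjectureAt_of_bsdp_of_nonsplit W p hWu h41 hGZK hp2 hmult hns hred
      (entireLFunction_one_ne_zero_of_analyticRank_eq_zero hpar W hr0) hbsd⟩

end Converse

/-! ## §4. Cell forms: the NON-SPLIT half of crux 3 (`MazurMCOnCellB`) is the `p`-part, cell by cell -/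

section CellForms

/-- **NON-SPLIT X2b pair: its TYPED INPUT `MissingInputB W p` from `p ∤ #Ш(E/ℚ)_an` at the pair
itself** (no relative): `CellB W p` (`r_an = 0`, `p ≠ 2`, `E[p]` reducible, multiplicative), `p`
non-split, `#Ш_an` a `p`-adic unit. [cite: Wuthrich2014, Thm. 16 (p. 397) and Prop. 21 (p. 400)]
[cite: GreenbergLNM1716, §4 pp. 112–113 ("the analogue of theorem 4.1")] -/
theorem missingInputB_of_cellB_of_not_split_of_shaAn_unit (hW21 : sha_dvd_analyticSha)
    (hWu : thm16_charIdeal_dvd_multiplicative_of_reducible)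
    (h41 : thm41Analogue_charValue_rankZero_numberField)
    (hGZK : rank_eq_analyticRank_of_analyticRank_le_one) (hpar : nonempty_modularParametrizationData)
    (W : WeierstrassCurve ℚ) [W.IsElliptic] [W.IsGloballyMinimal] (p : ℕ) [Fact p.Prime]
    (hc : CellB W p) (hns : ¬ W.HasSplitMultiplicativeReductionAtPrime p)
    (hunit : ∃ q : ℚ, shaAn W = (q : ℂ) ∧ padicValRat p q = 0) : MissingInputB W p :=
  mazurMainConjectureAt_of_shaAn_unit_of_nonsplit_of_analyticRank_eq_zero W p hW21 hWu h41 hGZK hpar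
    hc.2.1.1 hc.2.1.2.2 hns hc.2.1.2.1 hc.1 hunit

/-- **NON-SPLIT X2b pair: Mazur's main conjecture at the pair ⟺ Miller's `BSD(E,p)`** — so on the
non-split half of row A10 the per-pair content of crux 3 (`MazurMCOnCellB`) is EXACTLY the cell target
`X2.TargetB` (`CellB → BSDp`): modulo the published facts, what is missing at each non-split cell is the
LOWER bound `ord_p #Ш_an ≤ ord_p #Ш(E/ℚ)(p)` at the target (the upper bound is Wuthrich Prop. 21) —
a statement about `Ш`, nothing Iwasawa-theoretic. [cite: GreenbergLNM1716, §4 pp. 112–113 and §5]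
[cite: Wuthrich2014, Thm. 16 (p. 397)] [cite: SteinWuthrich2013, Thm. 6.1 (p. 20)] -/
theorem mazurMainConjectureAt_iff_bsdp_of_cellB_of_not_split
    (hWu : thm16_charIdeal_dvd_multiplicative_of_reducible)
    (h41 : thm41Analogue_charValue_rankZero_numberField)
    (hJn : thm61_nonsplitMultiplicative) (hHn : exists_isMultCanonical)
    (hGZK : rank_eq_analyticRank_of_analyticRank_le_one) (hmod : hasEntireLFunction_rat)
    (hpar : nonempty_modularParametrizationData)
    (W : WeierstrassCurve ℚ) [W.IsElliptic] [W.IsGloballyMinimal] (p : ℕ) [Fact p.Prime]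
    (hc : CellB W p) (hns : ¬ W.HasSplitMultiplicativeReductionAtPrime p) :
    X2.MazurMainConjectureAt W p ↔ BSDp W p :=
  mazurMainConjectureAt_iff_bsdp_of_nonsplit W p hWu h41 hJn hHn hGZK hmod hpar hc.2.1.1 hc.2.1.2.2 hns
    hc.2.1.2.1 hc.1

/-- **The NON-SPLIT half of crux 3 and the NON-SPLIT half of the cell target `TargetB` are ONE statement**
(modulo the published facts): `(∀ non-split CellB pairs, Mazur's MC) ↔ (∀ non-split CellB pairs, BSD(E,p))`.
Bookkeeping over `mazurMainConjectureAt_iff_bsdp_of_cellB_of_not_split`.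
[cite: GreenbergLNM1716, §4 pp. 112–113 and §5] [cite: Wuthrich2014, Thm. 16 (p. 397)]
[cite: SteinWuthrich2013, Thm. 6.1 (p. 20)] -/
theorem forall_cellB_nonsplit_mazurMainConjectureAt_iff_bsdp
    (hWu : thm16_charIdeal_dvd_multiplicative_of_reducible)
    (h41 : thm41Analogue_charValue_rankZero_numberField)
    (hJn : thm61_nonsplitMultiplicative) (hHn : exists_isMultCanonical)
    (hGZK : rank_eq_analyticRank_of_analyticRank_le_one) (hmod : hasEntireLFunction_rat)
    (hpar : nonempty_modularParametrizationData) :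
    (∀ (W : WeierstrassCurve ℚ) [W.IsElliptic] [W.IsGloballyMinimal] (p : ℕ) [Fact p.Prime],
        CellB W p → ¬ W.HasSplitMultiplicativeReductionAtPrime p → X2.MazurMainConjectureAt W p) ↔
      (∀ (W : WeierstrassCurve ℚ) [W.IsElliptic] [W.IsGloballyMinimal] (p : ℕ) [Fact p.Prime],
        CellB W p → ¬ W.HasSplitMultiplicativeReductionAtPrime p → BSDp W p) :=
  ⟨fun h W _ _ p _ hc hns ↦ (mazurMainConjectureAt_iff_bsdp_of_cellB_of_not_split hWu h41 hJn hHn hGZK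
      hmod hpar W p hc hns).mp (h W p hc hns),
    fun h W _ _ p _ hc hns ↦ (mazurMainConjectureAt_iff_bsdp_of_cellB_of_not_split hWu h41 hJn hHn hGZK
      hmod hpar W p hc hns).mpr (h W p hc hns)⟩

end CellForms

end Summit.BirchSwinnertonDyer.Rank1Residual.X2

end
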